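import Summits.Ventures.YMGap.RobustBall.TorusAxisTarget
import Summits.Ventures.YMGap.RobustBall.ZdPairwiseColumn
import Summits.Ventures.YMGap.SlabAreaLawDimensions
import Summits.Ventures.YMGap.Thresholds.OneLinkVarianceSD
import Summits.Ventures.YMGap.RobustBall.LimitStateClustering
import HarnessLib

/-!
# Robust ball (Y2) — TORUS CLUSTERING ON THE TIER-1 BALL AT THE AXIS RATE, SHARP FORM (margin only at the target):
# `TorusClusteringOnBall N d β ε₀ ε₁ r (8N/(θ(1−s₀))) (2 log θ⁻¹)` with the slope condition `≤ 1` and `s₀` the target row only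

HONEST FRAMING: venture file of the cell `pub-ymgap` (QuantumFields programme), track ROBUST-BALL, seat rb-p2 (g11).  Strong-coupling LATTICE statement on finite tori
`(ℤ/L)^d`, `L ≥ 3`, in the tree currency `ClustersWith` / `TorusClusteringOnBall(UpTo)`; the one-link modulus `OneLinkKRModulus N R K` is a hypothesis by name (cell: the
tree's quarter modulus for `SU(2)`); nothing continuum / Clay.
WHAT IS NEW over `TorusAxisClustering` (margin `s < 1` in every column inequality, constant `8N/(θ(1−s))`).  Föllmer's pairwise estimate needs the margin only AT THE
TARGET (`ZdPairwiseColumn.abs_covariance_le_pairwise_of_target`), and there the cycle eigenvector `g` (`TorusAxisCycle`) has slack: along the axis of the target link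
itself the staple offsets are `{+1, 0, −1}` and `g(±1) ≤ 2θ`, `g ≤ 2`, `g(0) ≥ 1`, so the TARGET ROW is `≤ A·2(d−1)(4θ+1) + 2√N ε₁` (`TorusAxisTarget.column_target_axis_le`).  RESULT (`clustersWith_axis_sharp`, `torusClusteringOnBall(UpTo)_axis_sharp`):
rows `A·6(d−1) + √Nε₁ < 1`, slope `A·P(θ) + √N ε₁ θ⁻¹^{2(r⊔1)+1} ≤ 1`, target `A·2(d−1)(4θ+1) + 2√Nε₁ ≤ s₀ < 1` (`A = K e^{ε₀}(1+2√Nε₁)|β|/N`) ⇒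
`ClustersWith W β (8N/(θ(1−s₀))) (2 log θ⁻¹)` for every member on every torus `L ≥ 3`.  `SU(2)`, `d = 4` cell: the ball `(1/100, 1/500, 1)` up to `β_W = 1/8`:
`TorusClusteringOnBallUpTo 2 4 (1/16) (1/100) (1/500) 1 96 (2 log 3)` (constant `96` against `1920` in `TorusAxisClustering`, same rate `2 log 3`); ★★ `SU(3)`, HYPOTHESIS-FREE
(PV modulus `K = 44/25`): the ball `(1/100, 1/2000, 1)` up to `β_W = 1/8`: `TorusClusteringOnBallUpTo 3 4 (1/24) (1/100) (1/2000) 1 144 (2 log 4)` (rate `2.77` per unit torus distance); and the `ℤ⁴` reading through ds-2's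
`limitState_abs_cov_le_onBall`: EVERY infinite-volume limit state of every family eventually in these balls clusters with `(96, 2 log 3)` resp. `(144, 2 log 4)`
(`su2_/su3_limitState_clustering_axis_sharp_oneEighth`).

References: H. Föllmer, LNM 1362 (1988), Ch. I, Thm. (2.13); the tree: `TorusAxisTarget`, `TorusAxisColumn`, `TorusAxisCycle`, `TorusDoor` (ds-2), `ZdPairwiseColumn`.
-/

noncomputable section

open MeasureTheory ProbabilityTheory Finset Function Real
open Literature.Probability.LatticeModels Literature.Probability.LatticeModels.DobrushinMetric
open Literature.MathematicalPhysics.QuantumLattice hiding torusNorm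
open Literature.MathematicalPhysics.QuantumFieldTheory hiding ZdEdge
open Literature.MathematicalPhysics.QuantumFieldTheory.Balaban1983to89.StrongCouplingTorusWindow
open Literature.MathematicalPhysics.QuantumFieldTheory.Balaban1983to89.StrongCouplingDobrushinWindow (OneLinkKRModulus)
open Summit.Ventures.YMGap.RobustBall.DobrushinPairwise Summit.Ventures.YMGap.RobustBall.ZdAxis

namespace Summit.Ventures.YMGap.RobustBall.TorusAxis

variable {d L N : ℕ} [NeZero L]

/-! ### The sharp clustering theorem -/

/-- **TORUS CLUSTERING AT THE AXIS RATE, SHARP FORM.**  `d ≥ 2`, `N ≥ 1`, `L ≥ 3`; modulus `OneLinkKRModulus N R K` on `R ≥ 2(d−1)|β|/N`; `0 < θ ≤ 1`;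
with `A = K e^{ε₀}(1+2√Nε₁)|β|/N`: ROWS `A·6(d−1) + √Nε₁ < 1`, SLOPE `A·max(P∥(θ), P⊥(θ)) + √N ε₁ θ⁻¹^{2(r⊔1)+1} ≤ 1`, TARGET `A·2(d−1)(4θ+1) + 2√Nε₁ ≤ s₀ < 1`.  Then every member
`W ∈ ClusterDomainFR ε₀ ε₁ r` satisfies `ClustersWith W β (8N/(θ(1−s₀))) (2 log θ⁻¹)`. [folklore] -/
theorem clustersWith_axis_sharp (hd : 2 ≤ d) (hN : 1 ≤ N) (hL : 3 ≤ L) {β ε₀ ε₁ R K θ s₀ : ℝ} {r : ℕ} (hK : 0 ≤ K)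
    (hR : |β| / N * (2 * ((d : ℝ) - 1)) ≤ R) (hmod : OneLinkKRModulus N R K) (hθ0 : 0 < θ) (hθ1 : θ ≤ 1)
    (hρ : K * Real.exp ε₀ * (1 + 2 * Real.sqrt N * ε₁) * (|β| / N) * (6 * ((d : ℝ) - 1)) + Real.sqrt N * ε₁ < 1)
    (hsup : K * Real.exp ε₀ * (1 + 2 * Real.sqrt N * ε₁) * (|β| / N) *
        max (2 * ((d : ℝ) - 1) * (θ + θ⁻¹ + 1)) (θ⁻¹ ^ 2 + 2 * θ⁻¹ + 2 * θ + θ ^ 2 + 6 * ((d : ℝ) - 2)) +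
      Real.sqrt N * ε₁ * θ⁻¹ ^ (2 * max r 1 + 1) ≤ 1)
    (hs0 : K * Real.exp ε₀ * (1 + 2 * Real.sqrt N * ε₁) * (|β| / N) * (2 * ((d : ℝ) - 1) * (4 * θ + 1)) + 2 * Real.sqrt N * ε₁ ≤ s₀)
    (hs1 : s₀ < 1) {W : Perturbation d L N} (hW : W ∈ ClusterDomainFR ε₀ ε₁ r) :
    ClustersWith W β (8 * N / (θ * (1 - s₀))) (2 * Real.log θ⁻¹) := by
  classical
  obtain ⟨hr, w, hwa, hwℓ⟩ := exists_witness_of_mem_clusterDomainFR hW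
  have hL1 : 1 < L := by omega
  have hL2 : 2 ≤ L := by omega
  have hd1 : 1 ≤ d := by omega
  haveI : NeZero (2 * L) := ⟨by omega⟩
  have hKR := isKRContraction_perturbedTorusSpec_of_hasRange (β := β) hd1 hN hL1 hK hR hmod w hr
  -- rows `≤ ρ < 1`
  set ρ : ℝ := K * Real.exp ε₀ * (1 + 2 * Real.sqrt N * ε₁) * (|β| / N) * (6 * ((d : ℝ) - 1)) + Real.sqrt N * ε₁ with hρdef
  have hrow : ∀ x : Edge d L, ∑ z ∈ (univ.erase x).filter (fun y => torusNorm (x.1 - y.1) ≤ max r 1),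
      (K * Real.exp (w.oscLoad 0 x) * (1 + 2 * Real.sqrt N * w.selfLipLoad 0 x) * (|β| / N) * tInfluence x z +
        Real.sqrt N * w.crossLip 0 x z) ≤ ρ := by
    intro x
    refine le_trans (Finset.sum_le_sum_of_subset_of_nonneg (Finset.filter_subset _ _) fun z _ _ => robustEntry_nonneg hK β w x z) ?_
    refine (sum_erase_robustEntry_le hd1 hL1 hK β w x).trans ?_
    have hℓs : w.selfLipLoad 0 x ≤ ε₁ := by linarith [hwℓ x, crossLipLoad_nonneg w 0 x]
    have hΛ : w.crossLipLoad 0 x ≤ ε₁ := by linarith [hwℓ x, selfLipLoad_nonneg w 0 x]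
    have hd2 : (2 : ℝ) ≤ d := by exact_mod_cast hd
    have hd6 : 0 ≤ 6 * ((d : ℝ) - 1) := by linarith
    have h1 : Real.exp (w.oscLoad 0 x) ≤ Real.exp ε₀ := Real.exp_le_exp.2 (hwa x)
    have h2 : 1 + 2 * Real.sqrt N * w.selfLipLoad 0 x ≤ 1 + 2 * Real.sqrt N * ε₁ := by
      have := mul_le_mul_of_nonneg_left hℓs (show 0 ≤ 2 * Real.sqrt N by positivity); linarith
    have h3 : 0 ≤ 1 + 2 * Real.sqrt N * w.selfLipLoad 0 x :=
      add_nonneg zero_le_one (mul_nonneg (by positivity) (selfLipLoad_nonneg w 0 x))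
    have hAle : K * Real.exp (w.oscLoad 0 x) * (1 + 2 * Real.sqrt N * w.selfLipLoad 0 x) * (|β| / N) ≤
        K * Real.exp ε₀ * (1 + 2 * Real.sqrt N * ε₁) * (|β| / N) := by
      calc K * Real.exp (w.oscLoad 0 x) * (1 + 2 * Real.sqrt N * w.selfLipLoad 0 x) * (|β| / N)
          ≤ K * Real.exp ε₀ * (1 + 2 * Real.sqrt N * w.selfLipLoad 0 x) * (|β| / N) := by gcongr
        _ ≤ K * Real.exp ε₀ * (1 + 2 * Real.sqrt N * ε₁) * (|β| / N) := by gcongr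
    exact add_le_add (mul_le_mul_of_nonneg_right hAle hd6) (mul_le_mul_of_nonneg_left hΛ (Real.sqrt_nonneg _))
  have hρ0 : 0 ≤ ρ := le_trans (Finset.sum_nonneg fun z _ => robustEntry_nonneg hK β w _ z) (hrow ((fun _ => 0), ⟨0, by omega⟩))
  -- the profile: minimum over the axes of the cycle eigenvector in the doubled coordinates
  obtain ⟨g, hg0, hg00, hg1, hgu, hgd, hdec⟩ := exists_cycleProfile_twoSided (M := 2 * L) (by omega) hθ0 hθ1
  have hg2 : ∀ k : ZMod (2 * L), g k ≤ 2 := fun k => by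
    have h := hdec k 0 (Nat.zero_le _) (by simpa using (ZMod.val_lt k).le)
    simpa using h
  have hval1 : (1 : ZMod (2 * L)).val = 1 := ZMod.val_one'' (by omega)
  have hgp1 : g 1 ≤ 2 * θ := by
    have h := hdec 1 1 (by rw [hval1]) (by rw [hval1]; omega)
    simpa using h
  have hgm1 : g (-1) ≤ 2 * θ := by
    have hvalm1 : (-1 : ZMod (2 * L)).val = 2 * L - 1 := by
      haveI : Fact (1 < 2 * L) := ⟨by omega⟩
      rw [ZMod.neg_val, if_neg one_ne_zero, hval1]
    have h := hdec (-1) 1 (by rw [hvalm1]; omega) (by rw [hvalm1]; omega)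
    simpa using h
  have huniv : (Finset.univ : Finset (Fin d)).Nonempty := ⟨⟨0, by omega⟩, Finset.mem_univ _⟩
  set Hc : Fin d → Edge d L → ZMod (2 * L) := fun i x => ((2 * (x.1 i).val : ℕ) : ZMod (2 * L)) + (if x.2 = i then 1 else 0)
    with hHc
  set p : Edge d L → Edge d L → ℝ := fun x y => Finset.univ.inf' huniv fun i => g (Hc i x - Hc i y) with hp
  have hp0 : ∀ x y, 0 ≤ p x y := fun x y => (Finset.le_inf'_iff huniv _).2 fun i _ => (hg0 _).le
  have hpyy : ∀ y, p y y = g 0 := fun y => by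
    refine le_antisymm ((Finset.inf'_le _ (Finset.mem_univ (⟨0, by omega⟩ : Fin d))).trans (by rw [sub_self])) ?_
    exact (Finset.le_inf'_iff huniv _).2 fun i _ => by rw [sub_self]
  have hpy : ∀ y, 0 < p y y := fun y => by rw [hpyy]; exact hg0 0
  -- off the target: margin-free columns (`column_axis_le` with `s = 1`)
  have hcol : ∀ (y x : Edge d L), x ≠ y → ∑ z ∈ (univ.erase x).filter (fun y => torusNorm (x.1 - y.1) ≤ max r 1),
      (K * Real.exp (w.oscLoad 0 x) * (1 + 2 * Real.sqrt N * w.selfLipLoad 0 x) * (|β| / N) * tInfluence x z +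
        Real.sqrt N * w.crossLip 0 x z) * p z y ≤ p x y := by
    intro y x _
    obtain ⟨i₀, -, hi₀⟩ := Finset.exists_mem_eq_inf' huniv (fun i => g (Hc i x - Hc i y))
    have hpx : p x y = g (Hc i₀ x - Hc i₀ y) := hi₀
    calc ∑ z ∈ (univ.erase x).filter (fun y => torusNorm (x.1 - y.1) ≤ max r 1),
          (K * Real.exp (w.oscLoad 0 x) * (1 + 2 * Real.sqrt N * w.selfLipLoad 0 x) * (|β| / N) * tInfluence x z +
            Real.sqrt N * w.crossLip 0 x z) * p z y
        ≤ ∑ z ∈ (univ.erase x).filter (fun y => torusNorm (x.1 - y.1) ≤ max r 1),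
          (K * Real.exp (w.oscLoad 0 x) * (1 + 2 * Real.sqrt N * w.selfLipLoad 0 x) * (|β| / N) * tInfluence x z +
            Real.sqrt N * w.crossLip 0 x z) * g (Hc i₀ z - Hc i₀ y) :=
          Finset.sum_le_sum fun z _ => mul_le_mul_of_nonneg_left (Finset.inf'_le _ (Finset.mem_univ i₀))
            (robustEntry_nonneg hK β w x z)
      _ ≤ 1 * g (Hc i₀ x - Hc i₀ y) := column_axis_le hd hL2 hK hθ0 hθ1 w hwa hwℓ hsup hg0 hg1 hgu hgd x i₀ (Hc i₀ y)
      _ = p x y := by rw [one_mul, hpx]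
  -- at the target: the row along the target link's own axis
  have hpt : ∀ y : Edge d L, ∑ z ∈ (univ.erase y).filter (fun z => torusNorm (y.1 - z.1) ≤ max r 1),
      (K * Real.exp (w.oscLoad 0 y) * (1 + 2 * Real.sqrt N * w.selfLipLoad 0 y) * (|β| / N) * tInfluence y z +
        Real.sqrt N * w.crossLip 0 y z) * p z y ≤ s₀ * p y y := by
    intro y
    rw [hpyy]
    calc _ ≤ ∑ z ∈ (univ.erase y).filter (fun z => torusNorm (y.1 - z.1) ≤ max r 1),
          (K * Real.exp (w.oscLoad 0 y) * (1 + 2 * Real.sqrt N * w.selfLipLoad 0 y) * (|β| / N) * tInfluence y z +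
            Real.sqrt N * w.crossLip 0 y z) * g (Hc y.2 z - Hc y.2 y) :=
          Finset.sum_le_sum fun z _ => mul_le_mul_of_nonneg_left (Finset.inf'_le _ (Finset.mem_univ y.2)) (robustEntry_nonneg hK β w y z)
      _ ≤ (K * Real.exp ε₀ * (1 + 2 * Real.sqrt N * ε₁) * (|β| / N) * (2 * ((d : ℝ) - 1) * (4 * θ + 1)) + 2 * Real.sqrt N * ε₁) * g 0 :=
          column_target_axis_le hd hL2 hK hθ0 w hwa hwℓ hg0 hg00 hg2 hgp1 hgm1 y
      _ ≤ s₀ * g 0 := mul_le_mul_of_nonneg_right hs0 (hg0 0).le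
  -- the pair profile bound from the torus distance (as in `clustersWith_axis`)
  have hpd : ∀ (x y : Edge d L) (n : ℕ), n ≤ torusNorm (x.1 - y.1) → p x y / p y y ≤ 2 * θ⁻¹ * (θ ^ 2) ^ n := by
    intro x y n hn
    rw [hpyy]
    refine (div_le_self (hp0 x y) hg00).trans ?_
    obtain ⟨i, -, hi⟩ := Finset.exists_mem_eq_sup (Finset.univ : Finset (Fin d)) huniv
      (fun j => (((x.1 - y.1) j).valMinAbs).natAbs)
    have hni : n ≤ ((x.1 i - y.1 i).valMinAbs).natAbs := by
      have h' : torusNorm (x.1 - y.1) = (((x.1 - y.1) i).valMinAbs).natAbs := hi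
      rw [h', Pi.sub_apply] at hn; exact hn
    refine (Finset.inf'_le _ (Finset.mem_univ i)).trans ?_
    obtain ⟨h1, h2⟩ := le_abs_val_sub_of_le_valMinAbs hni
    set δ : ℤ := ((x.1 i).val : ℤ) - (y.1 i).val with hδ
    set ex : ℤ := if x.2 = i then 1 else 0 with hex
    set ey : ℤ := if y.2 = i then 1 else 0 with hey
    have hex' : ex = 0 ∨ ex = 1 := by by_cases h : x.2 = i <;> simp [hex, h]
    have hey' : ey = 0 ∨ ey = 1 := by by_cases h : y.2 = i <;> simp [hey, h]
    have hva : ((x.1 i).val : ℤ) < L := by exact_mod_cast ZMod.val_lt (x.1 i)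
    have hvb : ((y.1 i).val : ℤ) < L := by exact_mod_cast ZMod.val_lt (y.1 i)
    have ha0 : (0 : ℤ) ≤ (x.1 i).val := by positivity
    have hb0 : (0 : ℤ) ≤ (y.1 i).val := by positivity
    have h1' := le_abs'.1 h1
    have h2' := abs_le.1 (show |δ| ≤ (L : ℤ) - n by linarith)
    set Kz : ℤ := 2 * δ + (ex - ey) with hKz
    have hHK : Hc i x - Hc i y = ((Kz : ℤ) : ZMod (2 * L)) := by
      simp only [hHc, hKz, hδ, hex, hey]; exact hc_sub_eq_intCast x y i
    have hj : (((2 * n - 1 : ℕ) : ℤ)) ≤ |Kz| := by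
      have : ((2 * n - 1 : ℕ) : ℤ) ≤ Kz ∨ ((2 * n - 1 : ℕ) : ℤ) ≤ -Kz := by omega
      rcases this with h | h
      · exact h.trans (le_abs_self Kz)
      · exact h.trans (neg_le_abs Kz)
    have hjK : ((2 * n - 1 : ℕ) : ℤ) + |Kz| ≤ ((2 * L : ℕ) : ℤ) := by
      have : |Kz| ≤ ((2 * L : ℕ) : ℤ) - ((2 * n - 1 : ℕ) : ℤ) := abs_le.2 ⟨by push_cast; omega, by push_cast; omega⟩
      linarith
    rw [hHK]
    refine (profile_intCast_le (M := 2 * L) hdec hj hjK).trans ?_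
    rw [mul_assoc]
    exact mul_le_mul_of_nonneg_left (pow_two_mul_sub_one_le' hθ0 hθ1 n) zero_le_two
  -- Föllmer's pairwise estimate with margin at the target
  intro f g' Δf Δg δf δg n hfm hgm hfdep hgdep hfb hgb hδf hδg hdist
  obtain ⟨Mf, hMf⟩ := hfb
  obtain ⟨Mg, hMg⟩ := hgb
  have key := abs_covariance_le_pairwise_of_target (isSpecification_perturbedTorusSpec W β) hKR (r := suFrobDist)
    (R := 2 * Real.sqrt N) suFrobDist_nonneg suFrobDist_le (by positivity) hρ0 hρ hrow (isGibbsMeasure_perturbedMeasure W β)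
    hfm hfdep hMf hδf hgm hgdep hMg hδg hs1 hp0 (fun y _ => hpy y) (fun y _ x hxy => hcol y x hxy) (fun y _ => hpt y)
  refine key.trans ?_
  have h1s : 0 < 1 - s₀ := by linarith
  have hsum : ∑ x ∈ Δf, ∑ y ∈ Δg, δf x * (p x y / p y y) * δg y ≤ ∑ x ∈ Δf, ∑ y ∈ Δg, δf x * (2 * θ⁻¹ * (θ ^ 2) ^ n) * δg y :=
    Finset.sum_le_sum fun x hx => Finset.sum_le_sum fun y hy =>
      mul_le_mul_of_nonneg_right (mul_le_mul_of_nonneg_left (hpd x y n (hdist x hx y hy)) (hδf.nonneg x)) (hδg.nonneg y)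
  have hN4 : (2 * Real.sqrt (N : ℝ)) ^ 2 = 4 * N := by rw [mul_pow, Real.sq_sqrt (by positivity)]; norm_num
  have hexp : Real.exp (-(2 * Real.log θ⁻¹) * n) = (θ ^ 2) ^ n := by
    rw [Real.log_inv, show -(2 * -Real.log θ) * (n : ℝ) = (n : ℝ) * Real.log (θ ^ 2) by rw [Real.log_pow]; push_cast; ring,
      Real.exp_nat_mul, Real.exp_log (by positivity)]
  calc (2 * Real.sqrt (N : ℝ)) ^ 2 / (1 - s₀) * ∑ x ∈ Δf, ∑ y ∈ Δg, δf x * (p x y / p y y) * δg y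
      ≤ (2 * Real.sqrt (N : ℝ)) ^ 2 / (1 - s₀) * ∑ x ∈ Δf, ∑ y ∈ Δg, δf x * (2 * θ⁻¹ * (θ ^ 2) ^ n) * δg y :=
        mul_le_mul_of_nonneg_left hsum (div_nonneg (sq_nonneg _) h1s.le)
    _ = 8 * N / (θ * (1 - s₀)) * (∑ y ∈ Δg, δg y) * (∑ x ∈ Δf, δf x) * Real.exp (-(2 * Real.log θ⁻¹) * n) := by
        have e : ∑ x ∈ Δf, ∑ y ∈ Δg, δf x * (2 * θ⁻¹ * (θ ^ 2) ^ n) * δg y = 2 * θ⁻¹ * (θ ^ 2) ^ n * ((∑ x ∈ Δf, δf x) * ∑ y ∈ Δg, δg y) := by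
          rw [Finset.sum_mul, Finset.mul_sum]
          refine Finset.sum_congr rfl fun x _ => ?_
          rw [Finset.mul_sum, Finset.mul_sum]
          exact Finset.sum_congr rfl fun y _ => by ring
        rw [e, hN4, hexp]
        field_simp
        ring

/-- **TORUS CLUSTERING ON THE WHOLE TIER-1 BALL, SHARP FORM, uniformly in `L ≥ 3`.** [folklore] -/
theorem torusClusteringOnBall_axis_sharp (hd : 2 ≤ d) (hN : 1 ≤ N) {β ε₀ ε₁ R K θ s₀ : ℝ} {r : ℕ} (hK : 0 ≤ K)
    (hR : |β| / N * (2 * ((d : ℝ) - 1)) ≤ R) (hmod : OneLinkKRModulus N R K) (hθ0 : 0 < θ) (hθ1 : θ ≤ 1)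
    (hρ : K * Real.exp ε₀ * (1 + 2 * Real.sqrt N * ε₁) * (|β| / N) * (6 * ((d : ℝ) - 1)) + Real.sqrt N * ε₁ < 1)
    (hsup : K * Real.exp ε₀ * (1 + 2 * Real.sqrt N * ε₁) * (|β| / N) *
        max (2 * ((d : ℝ) - 1) * (θ + θ⁻¹ + 1)) (θ⁻¹ ^ 2 + 2 * θ⁻¹ + 2 * θ + θ ^ 2 + 6 * ((d : ℝ) - 2)) +
      Real.sqrt N * ε₁ * θ⁻¹ ^ (2 * max r 1 + 1) ≤ 1)
    (hs0 : K * Real.exp ε₀ * (1 + 2 * Real.sqrt N * ε₁) * (|β| / N) * (2 * ((d : ℝ) - 1) * (4 * θ + 1)) + 2 * Real.sqrt N * ε₁ ≤ s₀)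
    (hs1 : s₀ < 1) :
    TorusClusteringOnBall N d β ε₀ ε₁ r (8 * N / (θ * (1 - s₀))) (2 * Real.log θ⁻¹) :=
  fun _L _ hL _W hW => clustersWith_axis_sharp hd hN hL hK hR hmod hθ0 hθ1 hρ hsup hs0 hs1 hW

/-- **… and UP TO `β⋆`** (`β⋆ ≥ 0`; every condition is monotone in `|β|`). [folklore] -/
theorem torusClusteringOnBallUpTo_axis_sharp (hd : 2 ≤ d) (hN : 1 ≤ N) {βs ε₀ ε₁ R K θ s₀ : ℝ} {r : ℕ} (hK : 0 ≤ K) (hε₁ : 0 ≤ ε₁)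
    (hR : βs / N * (2 * ((d : ℝ) - 1)) ≤ R) (hmod : OneLinkKRModulus N R K) (hθ0 : 0 < θ) (hθ1 : θ ≤ 1)
    (hρ : K * Real.exp ε₀ * (1 + 2 * Real.sqrt N * ε₁) * (βs / N) * (6 * ((d : ℝ) - 1)) + Real.sqrt N * ε₁ < 1)
    (hsup : K * Real.exp ε₀ * (1 + 2 * Real.sqrt N * ε₁) * (βs / N) *
        max (2 * ((d : ℝ) - 1) * (θ + θ⁻¹ + 1)) (θ⁻¹ ^ 2 + 2 * θ⁻¹ + 2 * θ + θ ^ 2 + 6 * ((d : ℝ) - 2)) +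
      Real.sqrt N * ε₁ * θ⁻¹ ^ (2 * max r 1 + 1) ≤ 1)
    (hs0 : K * Real.exp ε₀ * (1 + 2 * Real.sqrt N * ε₁) * (βs / N) * (2 * ((d : ℝ) - 1) * (4 * θ + 1)) + 2 * Real.sqrt N * ε₁ ≤ s₀)
    (hs1 : s₀ < 1) :
    TorusClusteringOnBallUpTo N d βs ε₀ ε₁ r (8 * N / (θ * (1 - s₀))) (2 * Real.log θ⁻¹) := by
  intro β hβ0 hβ
  have hab : |β| = β := abs_of_nonneg hβ0
  have hd2 : (2 : ℝ) ≤ d := by exact_mod_cast hd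
  have hd1 : 0 ≤ 2 * ((d : ℝ) - 1) := by linarith
  have hN0 : (0 : ℝ) < N := by exact_mod_cast hN
  have hdiv : |β| / N ≤ βs / N := by rw [hab]; exact div_le_div_of_nonneg_right hβ hN0.le
  have hP0 : 0 ≤ max (2 * ((d : ℝ) - 1) * (θ + θ⁻¹ + 1)) (θ⁻¹ ^ 2 + 2 * θ⁻¹ + 2 * θ + θ ^ 2 + 6 * ((d : ℝ) - 2)) :=
    le_max_of_le_left (mul_nonneg hd1 (by positivity))
  have hc0 : 0 ≤ K * Real.exp ε₀ * (1 + 2 * Real.sqrt N * ε₁) := by positivity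
  have h1 : K * Real.exp ε₀ * (1 + 2 * Real.sqrt N * ε₁) * (|β| / N) ≤ K * Real.exp ε₀ * (1 + 2 * Real.sqrt N * ε₁) * (βs / N) :=
    mul_le_mul_of_nonneg_left hdiv hc0
  refine torusClusteringOnBall_axis_sharp hd hN hK ((mul_le_mul_of_nonneg_right hdiv hd1).trans hR) hmod hθ0 hθ1
    (lt_of_le_of_lt (add_le_add (mul_le_mul_of_nonneg_right h1 (by linarith)) le_rfl) hρ)
    (le_trans (add_le_add (mul_le_mul_of_nonneg_right h1 hP0) le_rfl) hsup)
    (le_trans (add_le_add (mul_le_mul_of_nonneg_right h1 (mul_nonneg hd1 (by positivity))) le_rfl) hs0) hs1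

/-- ★★ **`SU(2)`, `d = 4`, the BALL `(ε₀, ε₁, r) = (1/100, 1/500, 1)` UP TO `β_W = 1/8`, SHARP FORM**: `θ = 1/3`, target margin `s₀ = 1/2`, i.e.
`TorusClusteringOnBallUpTo 2 4 (1/16) (1/100) (1/500) 1 96 (2 log 3)` — constant `96` (margin form: `1920`), rate `2 log 3 = 2.197` per unit of torus distance, every member,
every torus `L ≥ 3`, every coupling up to `β_W = 1/8`.  Checks at `β_W = 1/8`: rows `1.0267·(18/32) + √2/500 < 1`; slope `≤ 0.972 ≤ 1`; target
`1.0267·(1/32)·6·(7/3) + 2√2/500 ≤ 0.455 ≤ 1/2`. [folklore] -/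
theorem su2_torusClusteringOnBallUpTo_axis_sharp_oneEighth :
    TorusClusteringOnBallUpTo 2 4 (1 / 16) (1 / 100) (1 / 500) 1 96 (2 * Real.log 3) := by
  have hmod := SlabAreaLawDimensions.su2_oneLinkKRModulus_of_le_one (R := 3 / 16) (by norm_num)
  have hexp : Real.exp (1 / 100 : ℝ) ≤ 51 / 50 := by
    have h := Real.exp_bound_div_one_sub_of_interval' (x := 1 / 100) (by norm_num) (by norm_num)
    have : (1 : ℝ) / (1 - 1 / 100) ≤ 51 / 50 := by norm_num
    linarith
  have hsqrt : Real.sqrt 2 ≤ 3 / 2 := by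
    rw [show (3 / 2 : ℝ) = Real.sqrt ((3 / 2) ^ 2) by rw [Real.sqrt_sq (by norm_num)]]
    exact Real.sqrt_le_sqrt (by norm_num)
  have hcast : Real.sqrt ((2 : ℕ) : ℝ) = Real.sqrt 2 := by norm_num
  have h5 : 0 ≤ Real.sqrt 2 := Real.sqrt_nonneg _
  have h3 : Real.exp (1 / 100) * (1 + 2 * Real.sqrt 2 * (1 / 500)) ≤ 51 / 50 * (1 + 2 * (3 / 2) * (1 / 500)) :=
    mul_le_mul hexp (by linarith) (by positivity) (by norm_num)
  have hE0 : 0 < Real.exp (1 / 100 : ℝ) := Real.exp_pos _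
  have h := torusClusteringOnBallUpTo_axis_sharp (d := 4) (N := 2) (by norm_num) (by norm_num) (βs := 1 / 16) (ε₀ := 1 / 100) (ε₁ := 1 / 500)
    (θ := 1 / 3) (s₀ := 1 / 2) (r := 1) zero_le_one (by norm_num) (by norm_num) hmod (by norm_num) (by norm_num) ?_ ?_ ?_ (by norm_num)
  · have e1 : (8 * (2 : ℕ) / ((1 / 3 : ℝ) * (1 - 1 / 2))) = 96 := by norm_num
    have e2 : (2 * Real.log (1 / 3 : ℝ)⁻¹) = 2 * Real.log 3 := by norm_num
    rw [e1, e2] at h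
    exact h
  · rw [hcast]; push_cast; nlinarith [h3, hsqrt, h5, hE0]
  · have hmax : max (2 * ((4 : ℕ) - 1 : ℝ) * ((1 / 3 : ℝ) + (1 / 3)⁻¹ + 1))
        ((1 / 3 : ℝ)⁻¹ ^ 2 + 2 * (1 / 3 : ℝ)⁻¹ + 2 * (1 / 3) + (1 / 3) ^ 2 + 6 * ((4 : ℕ) - 2 : ℝ)) = 250 / 9 := by norm_num
    have hm1 : (2 * max 1 1 + 1 : ℕ) = 3 := by norm_num
    rw [hmax, hm1, hcast]
    nlinarith [h3, hsqrt, h5, hE0]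
  · rw [hcast]; push_cast; nlinarith [h3, hsqrt, h5, hE0]

/-- ★★ **… at `β_W = 1/8`**: `TorusClusteringOnBall 2 4 (1/16) (1/100) (1/500) 1 96 (2 log 3)`. [folklore] -/
theorem su2_torusClusteringOnBall_axis_sharp_oneEighth :
    TorusClusteringOnBall 2 4 (1 / 16) (1 / 100) (1 / 500) 1 96 (2 * Real.log 3) :=
  su2_torusClusteringOnBallUpTo_axis_sharp_oneEighth (1 / 16) (by norm_num) le_rfl

/-- ★★ **`SU(3)`, `d = 4`, the BALL `(ε₀, ε₁, r) = (1/100, 1/2000, 1)` UP TO `β_W = 1/8`, HYPOTHESIS-FREE, SHARP FORM** (tree couplings `0 ≤ β ≤ 1/24`, 't Hooft `β_W/9`;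
the tree's Poincaré × Schwinger–Dyson modulus `K = 44/25` on radius `1/12`, certificates `q = 126/125`, `p = 31/20`): `θ = 1/4`, target margin `s₀ = 1/3`, i.e.
`TorusClusteringOnBallUpTo 3 4 (1/24) (1/100) (1/2000) 1 144 (2 log 4)` — every member on every torus `L ≥ 3` clusters at rate `2 log 4 = 2.77` per unit of torus distance
(checks with `e^{1/100} ≤ 51/50`, `√3 ≤ 7/4`: rows `≤ 0.451 < 1`; slope `≤ 0.970 ≤ 1`; target `≤ 0.302 ≤ 1/3`). [folklore] -/
theorem su3_torusClusteringOnBallUpTo_axis_sharp_oneEighth :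
    TorusClusteringOnBallUpTo 3 4 (1 / 24) (1 / 100) (1 / 2000) 1 144 (2 * Real.log 4) := by
  have hmod : OneLinkKRModulus 3 (1 / 12) (44 / 25) :=
    Summit.Ventures.YMGap.OneLinkVarianceSD.su3_oneLinkKRModulus_pv_of_le (q := 126 / 125) (p := 31 / 20)
      (by norm_num) (by norm_num) (by norm_num) (by norm_num) (by norm_num) (by norm_num) (by norm_num)
  have hexp : Real.exp (1 / 100 : ℝ) ≤ 51 / 50 := by
    have h := Real.exp_bound_div_one_sub_of_interval' (x := 1 / 100) (by norm_num) (by norm_num)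
    have : (1 : ℝ) / (1 - 1 / 100) ≤ 51 / 50 := by norm_num
    linarith
  have hsqrt : Real.sqrt 3 ≤ 7 / 4 := by
    rw [show (7 / 4 : ℝ) = Real.sqrt ((7 / 4) ^ 2) by rw [Real.sqrt_sq (by norm_num)]]
    exact Real.sqrt_le_sqrt (by norm_num)
  have hcast : Real.sqrt ((3 : ℕ) : ℝ) = Real.sqrt 3 := by norm_num
  have h5 : 0 ≤ Real.sqrt 3 := Real.sqrt_nonneg _
  have h3 : Real.exp (1 / 100) * (1 + 2 * Real.sqrt 3 * (1 / 2000)) ≤ 51 / 50 * (1 + 2 * (7 / 4) * (1 / 2000)) :=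
    mul_le_mul hexp (by linarith) (by positivity) (by norm_num)
  have hE0 : 0 < Real.exp (1 / 100 : ℝ) := Real.exp_pos _
  have h := torusClusteringOnBallUpTo_axis_sharp (d := 4) (N := 3) (by norm_num) (by norm_num) (βs := 1 / 24) (ε₀ := 1 / 100) (ε₁ := 1 / 2000)
    (θ := 1 / 4) (s₀ := 1 / 3) (r := 1) (by norm_num) (by norm_num) (by norm_num) hmod (by norm_num) (by norm_num) ?_ ?_ ?_ (by norm_num)
  · have e1 : (8 * (3 : ℕ) / ((1 / 4 : ℝ) * (1 - 1 / 3))) = 144 := by norm_num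
    have e2 : (2 * Real.log (1 / 4 : ℝ)⁻¹) = 2 * Real.log 4 := by norm_num
    rw [e1, e2] at h
    exact h
  · rw [hcast]; push_cast; nlinarith [h3, hsqrt, h5, hE0]
  · have hmax : max (2 * ((4 : ℕ) - 1 : ℝ) * ((1 / 4 : ℝ) + (1 / 4)⁻¹ + 1))
        ((1 / 4 : ℝ)⁻¹ ^ 2 + 2 * (1 / 4 : ℝ)⁻¹ + 2 * (1 / 4) + (1 / 4) ^ 2 + 6 * ((4 : ℕ) - 2 : ℝ)) = 585 / 16 := by norm_num
    have hm1 : (2 * max 1 1 + 1 : ℕ) = 3 := by norm_num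
    rw [hmax, hm1, hcast]
    nlinarith [h3, hsqrt, h5, hE0]
  · rw [hcast]; push_cast; nlinarith [h3, hsqrt, h5, hE0]

/-! ### The `ℤ⁴` reading: every infinite-volume limit state of a member family (ds-2's `limitState_abs_cov_le_onBall`) -/

/-- ★★ **EVERY LIMIT STATE OF EVERY FAMILY EVENTUALLY IN THE BALL `(1/100, 1/500, 1)` CLUSTERS AT RATE `2 log 3` ON `ℤ⁴`** (`SU(2)`, tree coupling `1/16`,
i.e. `β_W = 1/8`): for every perturbation family `𝓦` eventually in `ClusterDomainFR (1/100) (1/500) 1`, EVERY infinite-volume limit point `μ` of its perturbed torus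
states, and all bounded continuous cylinder observables `f, g` with supports at sup-distance `≥ n` and `suFrobDist`-Lipschitz vectors `δ_f, δ_g`:
`|cov_μ(f,g)| ≤ 96 (Σδ_g)(Σδ_f) e^{−(2 log 3) n}` (ds-2's bridge `limitState_abs_cov_le_onBall`; compare `su2_limitState_clustering_starW_oneQuarter_t100`: rate `1/100`). [folklore] -/
theorem su2_limitState_clustering_axis_sharp_oneEighth {𝓦 : PerturbationFamily 4 2}
    (hW : ∀ᶠ L in Filter.atTop, 𝓦 L ∈ ClusterDomainFR (1 / 100) (1 / 500) 1) {μ : Measure (LGConfig 4 (SUN 2))}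
    (hμ : μ ∈ perturbedLimitPoints (1 / 16) 𝓦) {f g : LGConfig 4 (SUN 2) → ℝ} {Δf Δg : Finset (ZdEdge 4)}
    {δf δg : ZdEdge 4 → ℝ} {n : ℕ} (hfm : Measurable f) (hgm : Measurable g) (hfc : Continuous f) (hgc : Continuous g)
    (hfdep : IsCylinder f Δf) (hgdep : IsCylinder g Δg) (hfb : ∃ M, ∀ U, |f U| ≤ M) (hgb : ∃ M, ∀ U, |g U| ≤ M)
    (hflip : IsLipBound suFrobDist f δf) (hglip : IsLipBound suFrobDist g δg)
    (hdist : ∀ x ∈ Δf, ∀ y ∈ Δg, n ≤ Literature.Probability.LatticeModels.Site.supNorm (x.1 - y.1)) :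
    |cov[f, g; μ]| ≤ 96 * (∑ y ∈ Δg, δg y) * (∑ x ∈ Δf, δf x) * Real.exp (-(2 * Real.log 3) * n) :=
  limitState_abs_cov_le_onBall (su2_torusClusteringOnBallUpTo_axis_sharp_oneEighth (1 / 16) (by norm_num) le_rfl) hW hμ
    hfm hgm hfc hgc hfdep hgdep hfb hgb hflip hglip hdist

/-- ★★ **The same for `SU(3)`, HYPOTHESIS-FREE** (tree coupling `1/24`, i.e. `β_W = 1/8`; the ball `(1/100, 1/2000, 1)`): every limit state of every family eventually in
`ClusterDomainFR (1/100) (1/2000) 1` satisfies `|cov_μ(f,g)| ≤ 144 (Σδ_g)(Σδ_f) e^{−(2 log 4) n}` for cylinder observables at sup-distance `≥ n`. [folklore] -/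
theorem su3_limitState_clustering_axis_sharp_oneEighth {𝓦 : PerturbationFamily 4 3}
    (hW : ∀ᶠ L in Filter.atTop, 𝓦 L ∈ ClusterDomainFR (1 / 100) (1 / 2000) 1) {μ : Measure (LGConfig 4 (SUN 3))}
    (hμ : μ ∈ perturbedLimitPoints (1 / 24) 𝓦) {f g : LGConfig 4 (SUN 3) → ℝ} {Δf Δg : Finset (ZdEdge 4)}
    {δf δg : ZdEdge 4 → ℝ} {n : ℕ} (hfm : Measurable f) (hgm : Measurable g) (hfc : Continuous f) (hgc : Continuous g)
    (hfdep : IsCylinder f Δf) (hgdep : IsCylinder g Δg) (hfb : ∃ M, ∀ U, |f U| ≤ M) (hgb : ∃ M, ∀ U, |g U| ≤ M)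
    (hflip : IsLipBound suFrobDist f δf) (hglip : IsLipBound suFrobDist g δg)
    (hdist : ∀ x ∈ Δf, ∀ y ∈ Δg, n ≤ Literature.Probability.LatticeModels.Site.supNorm (x.1 - y.1)) :
    |cov[f, g; μ]| ≤ 144 * (∑ y ∈ Δg, δg y) * (∑ x ∈ Δf, δf x) * Real.exp (-(2 * Real.log 4) * n) :=
  limitState_abs_cov_le_onBall (su3_torusClusteringOnBallUpTo_axis_sharp_oneEighth (1 / 24) (by norm_num) le_rfl) hW hμ
    hfm hgm hfc hgc hfdep hgdep hfb hgb hflip hglip hdist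

end Summit.Ventures.YMGap.RobustBall.TorusAxis

end
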